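import Summits.QuantumFields.BalabanUV.Beta.GAN24.ContactFaceJumpStaircase
import Summits.QuantumFields.BalabanUV.Beta.GAN24.ContactLambdaCommutator

/-!
# `BalabanUV.Beta.GAN24.ContactFaceJumpCommutator` — binder row G-an2-4 / (CONV-C), CT-ROUTE, the row owner's `gen20/BORNSEC-PLAN-v1.md` v1.1 §A (Λ-C)(C3) + AMENDMENT
# [GAN24P1-G20-A1] «(C3) STATEMENT», PART 3: **THE COMMUTATOR `[𝒬^ρ_L, ψ̄]B` OF leaf-02 g48's `ContactLambdaCommutator` IS LOCALISED — for a block-constant `ψ` it is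
# the ONE face jump times the contour mass of `B`; for staircases only the crossed scales + the finest piece enter; against a staircase GRADIENT the two coarse jump sums
# never multiply**

NOT IN PRINT; OUR BOOKKEEPING (G-an2-4 formalisation swarm → CRUX TEAM (2), leaf prover `b2b-balaban-gan24-formalise-leaf-01`, gen 60; INTENT «FACE-JUMP» journal
`CLAIMS.log` l.33586 ∕ l.33736; names PROVISIONAL — the owner may rename ∕ re-cut).  [folklore] bookkeeping over PARTS 1–2 (`ContactFaceJump`, `ContactFaceJumpStaircase`)
and leaf-02 g48's `ContactLambdaCommutator.linAvgAt_eq_sum_linCountAt` (p290272) BY NAME; 0 `def`, 0 cited facts, 0 `def … : Prop`, 0 sorry.  HONEST FRAMING (cell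
contract, verbatim): «discharging `BetaPertH` makes Bałaban's UV stability UNCONDITIONAL — a real constructive-QFT result; it is NOT the continuum limit and NOT the Clay
problem.»  HONEST DEPENDENCY (verbatim): «continuum YM on T⁴ ⇐ BetaPertH ∧ nine spine estimates (0/9 proved); BetaPertH ⇐ (D1) ∧ (D4) ∧ CAP+tail; G-an2-4 gates asym,
D1 and NE2/3/4.»

## What (generic `d`; box root `ρ = toSite r`; the commutator written INLINE as in leaf-02's `tsum_sum_mul_gaugeWeight_mul_linKerAt`:
## `[𝒬^ρ_L, ψ̄]B (μ,y) := linAvgAt ρ (fun α x ↦ (ψ x + ψ(x+e_α))·B α x) L μ y − (ψ(L·y+ρ) + ψ(L·y+ρ+L·e_μ))·linAvgAt ρ B L μ y`)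
* §1 **`commutator_eq_sum`**: `[𝒬^ρ_L, ψ̄]B (μ,y) = Σ_{x ∈ nearBox L y} Σ_α (w₄(ψ; α,x; μ,y)·linCountAt ρ L μ y (α,x))·B α x` (leaf-02's expansion twice).
* §2 **`abs_commutator_le_of_blockConst`** (`ψ = h ∘ blk L`): `|[𝒬^ρ_L, ψ̄]B (μ,y)| ≤ |h(y+e_μ) − h y|·Σ_{x ∈ nearBox L y} Σ_α |linCountAt ρ L μ y (α,x)|·|B α x|` — the owner's
  «`½ΔG·(q⁻ − q⁺)[B]`» in absolute value.
* §3 **`abs_commutator_le_of_staircase`** (`ψ u = Σ_{s<n+1} G s (blk (Lc^s) u)`, one step `L = Lc`): `≤ Σ_x Σ_α (|w₄(G 0; α,x; μ,y)| + J(μ,y))·|count(α,x)|·|B α x|`,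
  `J(μ,y) = Σ_{s<n} |G (s+1) (blk (Lc^s) (y+e_μ)) − G (s+1) (blk (Lc^s) y)|` (only the crossed scales: PART 2 `jump_eq_zero_of_not_dvd`), and with a uniform finest-piece letter
  `|w₄(G 0)| ≤ W₀` and `|B| ≤ M` on the bonds of the contours: **`abs_commutator_le_of_staircase_of_le`** `≤ (W₀ + J(μ,y))·M·Σ_x Σ_α |count(α,x)|` — the owner's A1 form
  «`C_L·α·(Lc^{s(y,μ)} + 1)·sup_{pair}|B|`».
* §4 THE ΔΔ COMMUTATOR **`abs_commutator_dz_le_of_staircase`** (`B = dz ψ_b`, `ψ_b` a second staircase): `|[𝒬^ρ_L, ψ̄_a](dz ψ_b)(μ,y)| ≤ Σ_x Σ_α (|w₄(G_a 0)|·(|dz (G_b 0) α x| + J_b)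
  + J_a·|dz (G_b 0) α x|)·|count(α,x)|` — NO `J_a·J_b` (PART 1 `weight_mul_dz_mul_linCountAt_eq_zero`); uniform form **`abs_commutator_dz_le_of_staircase_of_le`**
  `≤ (W_a·(g_b + J_b) + J_a·g_b)·Σ_x Σ_α |count(α,x)|` — the owner's A1 «`C_L·α²·(Lc^{s(y,μ)} + 1)`» once `W_a, g_b ≲ α` and `J ≲ α·Lc^{s(y,μ)}` are read from `ContactGaugeStaircase`.
* §5 the crude contour-mass constant `sum_abs_linCountAt_le` (`Σ_{x ∈ nearBox} Σ_α |count(α,x)| ≤ #nearBox·(d+1)·L^{d+1}·ell (d+1) L`, an1's `abs_linCountAt_le`).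
(C5) — the face DENSITY `Σ'_y E y·Σ_{s<n}[Lc^s ∣ y_μ+1]·2a(s+1) = (Σ_s 2a(s+1)·Lc^{−s})·Σ'E` (the owner's (F2) scale by scale; ONE log for geometric letters) — is
leaf-03 g54's «FACE-DENSITY (C5)» `StaircaseFaceDensity` (journal l.33767), in THIS file's letter currency; not carried here.
Discharges NO slot letter; NO estimate of Bałaban's; 0 wall binders; NEVER «G-an2-4 closed»; NOT D1, NOT BetaPertH, NOT continuum, NOT Clay.
-/

noncomputable section

open Finset
open scoped BigOperators
open Literature.MathematicalPhysics.QuantumFieldTheory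
open Literature.MathematicalPhysics.QuantumFieldTheory.Balaban1983to89
open Literature.MathematicalPhysics.QuantumFieldTheory.Balaban1983to89.Beta
open AffineAveraging (Form0 Form1 Site box toSite unitVec unitVec_apply dz)
open AveragingContours (blk blk_block)
open AveragingContoursRooted (linAvgAt)
open AveragingHessianKernels (ell)
open AveragingHessianKernelsRooted (linCountAt linKerAt abs_linCountAt_le)
open Summit.QuantumFields.BalabanUV.Beta.LinearGaugeVH (nearBox mem_nearBox)
open Summit.QuantumFields.BalabanUV.Beta.GAN24.ContactLambdaCommutator (linAvgAt_eq_sum_linCountAt)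
open Summit.QuantumFields.BalabanUV.Beta.GAN24.ContactFaceJump (abs_weight_mul_linCountAt_le)
open Summit.QuantumFields.BalabanUV.Beta.GAN24.ContactFaceJumpStaircase (staircase_split abs_hplus_jump_le abs_weight_mul_dz_staircase_mul_linCountAt_le)

namespace Summit.QuantumFields.BalabanUV.Beta.GAN24.ContactFaceJumpCommutator

variable {d : ℕ} {L : ℕ} {r : Fin (d + 1) → ℕ}

/-! ## §1 The commutator expanded over the bonds of the support box -/

/-- NOT IN PRINT; OUR BOOKKEEPING.  **THE COMMUTATOR OVER BONDS** (box root; every `ψ`, every real 1-form `B`):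
`linAvgAt ρ (ψ̄•B) L μ y − Ψ̄_ρ(μ,y)·linAvgAt ρ B L μ y = Σ_{x ∈ nearBox L y} Σ_α (w₄(ψ; α,x; μ,y)·linCountAt ρ L μ y (α,x))·B α x`. -/
theorem commutator_eq_sum (hr : r ∈ box (d + 1) L) (ψ : Site (d + 1) → ℝ) (B : Form1 (d + 1) ℝ) (μ : Fin (d + 1)) (y : Site (d + 1)) :
    linAvgAt (toSite r) (fun α x => (ψ x + ψ (x + unitVec α)) * B α x) L μ y
        - (ψ ((L : ℤ) • y + toSite r) + ψ ((L : ℤ) • y + toSite r + (L : ℤ) • unitVec μ)) * linAvgAt (toSite r) B L μ y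
      = ∑ x ∈ nearBox L y, ∑ α,
          ((ψ x + ψ (x + unitVec α) - ψ ((L : ℤ) • y + toSite r) - ψ ((L : ℤ) • y + toSite r + (L : ℤ) • unitVec μ))
            * (linCountAt (toSite r) L μ y (α, x) : ℝ)) * B α x := by
  rw [linAvgAt_eq_sum_linCountAt hr, linAvgAt_eq_sum_linCountAt hr B, Finset.mul_sum, ← Finset.sum_sub_distrib]
  refine Finset.sum_congr rfl fun x _ => ?_
  rw [Finset.mul_sum, ← Finset.sum_sub_distrib]
  refine Finset.sum_congr rfl fun α _ => ?_
  ring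

/-- [folklore] The termwise bound summed: if `|w₄(ψ; α,x; μ,y)·count(α,x)| ≤ F α x·|count(α,x)|` for every bond then
`|[𝒬^ρ_L, ψ̄]B (μ,y)| ≤ Σ_x Σ_α F α x·|count(α,x)|·|B α x|`. -/
theorem abs_commutator_le_of_forall (hr : r ∈ box (d + 1) L) (ψ : Site (d + 1) → ℝ) (B : Form1 (d + 1) ℝ) (μ : Fin (d + 1)) (y : Site (d + 1))
    {F : Form1 (d + 1) ℝ}
    (hF : ∀ α x, |(ψ x + ψ (x + unitVec α) - ψ ((L : ℤ) • y + toSite r) - ψ ((L : ℤ) • y + toSite r + (L : ℤ) • unitVec μ))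
        * (linCountAt (toSite r) L μ y (α, x) : ℝ)| ≤ F α x * |(linCountAt (toSite r) L μ y (α, x) : ℝ)|) :
    |linAvgAt (toSite r) (fun α x => (ψ x + ψ (x + unitVec α)) * B α x) L μ y
        - (ψ ((L : ℤ) • y + toSite r) + ψ ((L : ℤ) • y + toSite r + (L : ℤ) • unitVec μ)) * linAvgAt (toSite r) B L μ y|
      ≤ ∑ x ∈ nearBox L y, ∑ α, F α x * |(linCountAt (toSite r) L μ y (α, x) : ℝ)| * |B α x| := by
  rw [commutator_eq_sum hr]
  refine (Finset.abs_sum_le_sum_abs _ _).trans (Finset.sum_le_sum fun x _ => (Finset.abs_sum_le_sum_abs _ _).trans (Finset.sum_le_sum fun α _ => ?_))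
  rw [abs_mul]
  exact mul_le_mul_of_nonneg_right (hF α x) (abs_nonneg _)

/-! ## §2 Block-constant gauge functions -/

/-- NOT IN PRINT; OUR BOOKKEEPING.  **THE COMMUTATOR WITH A BLOCK-CONSTANT GAUGE FUNCTION IS THE ONE FACE JUMP TIMES THE CONTOUR MASS** (box root, `1 ≤ L`):
`ψ = h ∘ blk L` ⇒ `|[𝒬^ρ_L, ψ̄]B (μ,y)| ≤ |h(y+e_μ) − h y|·Σ_{x ∈ nearBox L y} Σ_α |linCountAt ρ L μ y (α,x)|·|B α x|`. -/
theorem abs_commutator_le_of_blockConst (hL : 1 ≤ L) (hr : r ∈ box (d + 1) L) {ψ : Site (d + 1) → ℝ} (h : Site (d + 1) → ℝ)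
    (hψ : ∀ u, ψ u = h (blk L u)) (B : Form1 (d + 1) ℝ) (μ : Fin (d + 1)) (y : Site (d + 1)) :
    |linAvgAt (toSite r) (fun α x => (ψ x + ψ (x + unitVec α)) * B α x) L μ y
        - (ψ ((L : ℤ) • y + toSite r) + ψ ((L : ℤ) • y + toSite r + (L : ℤ) • unitVec μ)) * linAvgAt (toSite r) B L μ y|
      ≤ |h (y + unitVec μ) - h y| * ∑ x ∈ nearBox L y, ∑ α, |(linCountAt (toSite r) L μ y (α, x) : ℝ)| * |B α x| := by
  refine (abs_commutator_le_of_forall hr ψ B μ y (F := fun _ _ => |h (y + unitVec μ) - h y|)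
    (fun α x => abs_weight_mul_linCountAt_le hL hr h hψ μ y α x)).trans (le_of_eq ?_)
  rw [Finset.mul_sum]
  refine Finset.sum_congr rfl fun x _ => ?_
  rw [Finset.mul_sum]
  refine Finset.sum_congr rfl fun α _ => ?_
  ring

/-! ## §3 Staircases -/

section Staircase

variable {Lc : ℕ} {rr : Fin (d + 1) → ℕ}

/-- NOT IN PRINT; OUR BOOKKEEPING.  **THE COMMUTATOR WITH A STAIRCASE GAUGE FUNCTION: THE FINEST PIECE + THE JUMPS OF THE CROSSED SCALES** (one step `L = Lc`, box root):
`|[𝒬^ρ_{Lc}, ψ̄]B (μ,y)| ≤ Σ_{x ∈ nearBox} Σ_α (|w₄(G 0; α,x; μ,y)| + J(μ,y))·|count(α,x)|·|B α x|`, `J(μ,y) = Σ_{s<n} |G (s+1) (blk (Lc^s) (y+e_μ)) − G (s+1) (blk (Lc^s) y)|`. -/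
theorem abs_commutator_le_of_staircase (hLc : 1 ≤ Lc) (hrr : rr ∈ box (d + 1) Lc) (G : ℕ → Site (d + 1) → ℝ) (n : ℕ)
    {ψ : Site (d + 1) → ℝ} (hψ : ∀ u, ψ u = ∑ s ∈ Finset.range (n + 1), G s (blk (Lc ^ s) u)) (B : Form1 (d + 1) ℝ) (μ : Fin (d + 1)) (y : Site (d + 1)) :
    |linAvgAt (toSite rr) (fun α x => (ψ x + ψ (x + unitVec α)) * B α x) Lc μ y
        - (ψ ((Lc : ℤ) • y + toSite rr) + ψ ((Lc : ℤ) • y + toSite rr + (Lc : ℤ) • unitVec μ)) * linAvgAt (toSite rr) B Lc μ y|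
      ≤ ∑ x ∈ nearBox Lc y, ∑ α,
          (|G 0 x + G 0 (x + unitVec α) - G 0 ((Lc : ℤ) • y + toSite rr) - G 0 ((Lc : ℤ) • y + toSite rr + (Lc : ℤ) • unitVec μ)|
            + ∑ s ∈ Finset.range n, |G (s + 1) (blk (Lc ^ s) (y + unitVec μ)) - G (s + 1) (blk (Lc ^ s) y)|)
          * |(linCountAt (toSite rr) Lc μ y (α, x) : ℝ)| * |B α x| := by
  refine abs_commutator_le_of_forall hrr ψ B μ y fun α x => ?_
  -- termwise: finest piece + block-constant part (PART 1 on `linCountAt`)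
  set q : ℝ := (linCountAt (toSite rr) Lc μ y (α, x) : ℝ)
  set hp : Site (d + 1) → ℝ := fun y' => ∑ s ∈ Finset.range n, G (s + 1) (blk (Lc ^ s) y') with hhp
  have hψ' : ∀ u, ψ u = G 0 u + hp (blk Lc u) := fun u => by rw [hψ, staircase_split]
  have e : (ψ x + ψ (x + unitVec α) - ψ ((Lc : ℤ) • y + toSite rr) - ψ ((Lc : ℤ) • y + toSite rr + (Lc : ℤ) • unitVec μ)) * q
      = (G 0 x + G 0 (x + unitVec α) - G 0 ((Lc : ℤ) • y + toSite rr) - G 0 ((Lc : ℤ) • y + toSite rr + (Lc : ℤ) • unitVec μ)) * q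
        + ((fun u => hp (blk Lc u)) x + (fun u => hp (blk Lc u)) (x + unitVec α) - (fun u => hp (blk Lc u)) ((Lc : ℤ) • y + toSite rr)
            - (fun u => hp (blk Lc u)) ((Lc : ℤ) • y + toSite rr + (Lc : ℤ) • unitVec μ)) * q := by
    simp only [hψ']; ring
  rw [e, add_mul]
  refine (abs_add_le _ _).trans (add_le_add (le_of_eq (abs_mul _ _)) ?_)
  refine (abs_weight_mul_linCountAt_le hLc hrr hp (fun _ => rfl) μ y α x).trans (mul_le_mul_of_nonneg_right ?_ (abs_nonneg _))
  rw [hhp]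
  exact abs_hplus_jump_le G n μ y

/-- NOT IN PRINT; OUR BOOKKEEPING.  **UNIFORM FORM** (the owner's A1 «`C_L·α·(Lc^{s(y,μ)} + 1)·sup_{pair}|B|`»): with a finest-piece letter `|w₄(G 0; α,x; μ,y)| ≤ W₀` and a leg
letter `|B α x| ≤ M` on the support box, `|[𝒬^ρ_{Lc}, ψ̄]B (μ,y)| ≤ (W₀ + J(μ,y))·M·Σ_{x ∈ nearBox} Σ_α |count(α,x)|`. -/
theorem abs_commutator_le_of_staircase_of_le (hLc : 1 ≤ Lc) (hrr : rr ∈ box (d + 1) Lc) (G : ℕ → Site (d + 1) → ℝ) (n : ℕ)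
    {ψ : Site (d + 1) → ℝ} (hψ : ∀ u, ψ u = ∑ s ∈ Finset.range (n + 1), G s (blk (Lc ^ s) u)) (B : Form1 (d + 1) ℝ) (μ : Fin (d + 1)) (y : Site (d + 1))
    {W₀ M : ℝ}
    (hW : ∀ α, ∀ x ∈ nearBox Lc y, |G 0 x + G 0 (x + unitVec α) - G 0 ((Lc : ℤ) • y + toSite rr) - G 0 ((Lc : ℤ) • y + toSite rr + (Lc : ℤ) • unitVec μ)| ≤ W₀)
    (hB : ∀ α, ∀ x ∈ nearBox Lc y, |B α x| ≤ M) :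
    |linAvgAt (toSite rr) (fun α x => (ψ x + ψ (x + unitVec α)) * B α x) Lc μ y
        - (ψ ((Lc : ℤ) • y + toSite rr) + ψ ((Lc : ℤ) • y + toSite rr + (Lc : ℤ) • unitVec μ)) * linAvgAt (toSite rr) B Lc μ y|
      ≤ (W₀ + ∑ s ∈ Finset.range n, |G (s + 1) (blk (Lc ^ s) (y + unitVec μ)) - G (s + 1) (blk (Lc ^ s) y)|) * M
          * ∑ x ∈ nearBox Lc y, ∑ α, |(linCountAt (toSite rr) Lc μ y (α, x) : ℝ)| := by
  refine (abs_commutator_le_of_staircase hLc hrr G n hψ B μ y).trans ?_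
  rw [Finset.mul_sum]
  refine Finset.sum_le_sum fun x hx => ?_
  rw [Finset.mul_sum]
  refine Finset.sum_le_sum fun α _ => ?_
  have hJ : 0 ≤ ∑ s ∈ Finset.range n, |G (s + 1) (blk (Lc ^ s) (y + unitVec μ)) - G (s + 1) (blk (Lc ^ s) y)| :=
    Finset.sum_nonneg fun _ _ => abs_nonneg _
  have h1 := hW α x hx
  have h2 := hB α x hx
  have hq := abs_nonneg (linCountAt (toSite rr) Lc μ y (α, x) : ℝ)
  have hW0 : 0 ≤ W₀ := (abs_nonneg _).trans h1
  calc (|G 0 x + G 0 (x + unitVec α) - G 0 ((Lc : ℤ) • y + toSite rr) - G 0 ((Lc : ℤ) • y + toSite rr + (Lc : ℤ) • unitVec μ)|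
            + ∑ s ∈ Finset.range n, |G (s + 1) (blk (Lc ^ s) (y + unitVec μ)) - G (s + 1) (blk (Lc ^ s) y)|)
          * |(linCountAt (toSite rr) Lc μ y (α, x) : ℝ)| * |B α x|
        ≤ (W₀ + ∑ s ∈ Finset.range n, |G (s + 1) (blk (Lc ^ s) (y + unitVec μ)) - G (s + 1) (blk (Lc ^ s) y)|)
          * |(linCountAt (toSite rr) Lc μ y (α, x) : ℝ)| * M :=
          mul_le_mul (mul_le_mul_of_nonneg_right (by linarith) hq) h2 (abs_nonneg _) (mul_nonneg (by linarith) hq)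
    _ = (W₀ + ∑ s ∈ Finset.range n, |G (s + 1) (blk (Lc ^ s) (y + unitVec μ)) - G (s + 1) (blk (Lc ^ s) y)|) * M
          * |(linCountAt (toSite rr) Lc μ y (α, x) : ℝ)| := by ring

/-! ## §4 The ΔΔ commutator: against the gradient of a second staircase the two coarse jump sums never multiply -/

/-- NOT IN PRINT; OUR BOOKKEEPING.  **THE ΔΔ COMMUTATOR** (one step `L = Lc`, box root; `B = dz ψ_b`, `ψ_a`, `ψ_b` staircases with pieces `Ga`, `Gb`):
`|[𝒬^ρ_{Lc}, ψ̄_a](dz ψ_b)(μ,y)| ≤ Σ_x Σ_α (|w₄(Ga 0; α,x; μ,y)|·(|dz (Gb 0) α x| + J_b(μ,y)) + J_a(μ,y)·|dz (Gb 0) α x|)·|count(α,x)|` — NO `J_a·J_b` term. -/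
theorem abs_commutator_dz_le_of_staircase (hLc : 1 ≤ Lc) (hrr : rr ∈ box (d + 1) Lc) (Ga Gb : ℕ → Site (d + 1) → ℝ) (na nb : ℕ)
    {ψa ψb : Site (d + 1) → ℝ} (hψa : ∀ u, ψa u = ∑ s ∈ Finset.range (na + 1), Ga s (blk (Lc ^ s) u))
    (hψb : ∀ u, ψb u = ∑ s ∈ Finset.range (nb + 1), Gb s (blk (Lc ^ s) u)) (μ : Fin (d + 1)) (y : Site (d + 1)) :
    |linAvgAt (toSite rr) (fun α x => (ψa x + ψa (x + unitVec α)) * dz ψb α x) Lc μ y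
        - (ψa ((Lc : ℤ) • y + toSite rr) + ψa ((Lc : ℤ) • y + toSite rr + (Lc : ℤ) • unitVec μ)) * linAvgAt (toSite rr) (dz ψb) Lc μ y|
      ≤ ∑ x ∈ nearBox Lc y, ∑ α,
          (|Ga 0 x + Ga 0 (x + unitVec α) - Ga 0 ((Lc : ℤ) • y + toSite rr) - Ga 0 ((Lc : ℤ) • y + toSite rr + (Lc : ℤ) • unitVec μ)|
              * (|dz (Gb 0) α x| + ∑ s ∈ Finset.range nb, |Gb (s + 1) (blk (Lc ^ s) (y + unitVec μ)) - Gb (s + 1) (blk (Lc ^ s) y)|)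
            + (∑ s ∈ Finset.range na, |Ga (s + 1) (blk (Lc ^ s) (y + unitVec μ)) - Ga (s + 1) (blk (Lc ^ s) y)|) * |dz (Gb 0) α x|)
          * |(linCountAt (toSite rr) Lc μ y (α, x) : ℝ)| := by
  rw [commutator_eq_sum hrr]
  refine (Finset.abs_sum_le_sum_abs _ _).trans (Finset.sum_le_sum fun x _ => (Finset.abs_sum_le_sum_abs _ _).trans (Finset.sum_le_sum fun α _ => ?_))
  have h := abs_weight_mul_dz_staircase_mul_linCountAt_le hLc hrr Ga Gb na nb hψa hψb μ y α x
  have e : (ψa x + ψa (x + unitVec α) - ψa ((Lc : ℤ) • y + toSite rr) - ψa ((Lc : ℤ) • y + toSite rr + (Lc : ℤ) • unitVec μ))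
        * (linCountAt (toSite rr) Lc μ y (α, x) : ℝ) * dz ψb α x
      = (ψa x + ψa (x + unitVec α) - ψa ((Lc : ℤ) • y + toSite rr) - ψa ((Lc : ℤ) • y + toSite rr + (Lc : ℤ) • unitVec μ))
        * (ψb (x + unitVec α) - ψb x) * (linCountAt (toSite rr) Lc μ y (α, x) : ℝ) := by
    simp only [dz]; ring
  rw [e]
  simpa only [dz] using h

/-- NOT IN PRINT; OUR BOOKKEEPING.  **UNIFORM FORM OF THE ΔΔ COMMUTATOR** (the owner's A1 «`C_L·α²·(Lc^{s(y,μ)} + 1)`»): with finest-piece letters `|w₄(Ga 0; α,x; μ,y)| ≤ W_a` and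
`|dz (Gb 0) α x| ≤ g_b` on the support box, `|[𝒬^ρ_{Lc}, ψ̄_a](dz ψ_b)(μ,y)| ≤ (W_a·(g_b + J_b(μ,y)) + J_a(μ,y)·g_b)·Σ_{x ∈ nearBox} Σ_α |count(α,x)|`. -/
theorem abs_commutator_dz_le_of_staircase_of_le (hLc : 1 ≤ Lc) (hrr : rr ∈ box (d + 1) Lc) (Ga Gb : ℕ → Site (d + 1) → ℝ) (na nb : ℕ)
    {ψa ψb : Site (d + 1) → ℝ} (hψa : ∀ u, ψa u = ∑ s ∈ Finset.range (na + 1), Ga s (blk (Lc ^ s) u))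
    (hψb : ∀ u, ψb u = ∑ s ∈ Finset.range (nb + 1), Gb s (blk (Lc ^ s) u)) (μ : Fin (d + 1)) (y : Site (d + 1))
    {Wa gb : ℝ} (hWa0 : 0 ≤ Wa)
    (hWa : ∀ α, ∀ x ∈ nearBox Lc y, |Ga 0 x + Ga 0 (x + unitVec α) - Ga 0 ((Lc : ℤ) • y + toSite rr) - Ga 0 ((Lc : ℤ) • y + toSite rr + (Lc : ℤ) • unitVec μ)| ≤ Wa)
    (hgb : ∀ α, ∀ x ∈ nearBox Lc y, |dz (Gb 0) α x| ≤ gb) :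
    |linAvgAt (toSite rr) (fun α x => (ψa x + ψa (x + unitVec α)) * dz ψb α x) Lc μ y
        - (ψa ((Lc : ℤ) • y + toSite rr) + ψa ((Lc : ℤ) • y + toSite rr + (Lc : ℤ) • unitVec μ)) * linAvgAt (toSite rr) (dz ψb) Lc μ y|
      ≤ (Wa * (gb + ∑ s ∈ Finset.range nb, |Gb (s + 1) (blk (Lc ^ s) (y + unitVec μ)) - Gb (s + 1) (blk (Lc ^ s) y)|)
            + (∑ s ∈ Finset.range na, |Ga (s + 1) (blk (Lc ^ s) (y + unitVec μ)) - Ga (s + 1) (blk (Lc ^ s) y)|) * gb)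
          * ∑ x ∈ nearBox Lc y, ∑ α, |(linCountAt (toSite rr) Lc μ y (α, x) : ℝ)| := by
  refine (abs_commutator_dz_le_of_staircase hLc hrr Ga Gb na nb hψa hψb μ y).trans ?_
  rw [Finset.mul_sum]
  refine Finset.sum_le_sum fun x hx => ?_
  rw [Finset.mul_sum]
  refine Finset.sum_le_sum fun α _ => ?_
  have hJa : 0 ≤ ∑ s ∈ Finset.range na, |Ga (s + 1) (blk (Lc ^ s) (y + unitVec μ)) - Ga (s + 1) (blk (Lc ^ s) y)| :=
    Finset.sum_nonneg fun _ _ => abs_nonneg _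
  have hJb : 0 ≤ ∑ s ∈ Finset.range nb, |Gb (s + 1) (blk (Lc ^ s) (y + unitVec μ)) - Gb (s + 1) (blk (Lc ^ s) y)| :=
    Finset.sum_nonneg fun _ _ => abs_nonneg _
  have h1 := hWa α x hx
  have h2 := hgb α x hx
  have h0 := abs_nonneg (Ga 0 x + Ga 0 (x + unitVec α) - Ga 0 ((Lc : ℤ) • y + toSite rr) - Ga 0 ((Lc : ℤ) • y + toSite rr + (Lc : ℤ) • unitVec μ))
  have h0' := abs_nonneg (dz (Gb 0) α x)
  exact mul_le_mul_of_nonneg_right (by gcongr) (abs_nonneg _)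

end Staircase

/-! ## §5 The crude contour-mass constant -/

/-- [folklore] `Σ_{x ∈ nearBox L y} Σ_α |linCountAt ρ L μ y (α,x)| ≤ #nearBox·(d+1)·(L^{d+1}·ell (d+1) L)` (an1's `abs_linCountAt_le` per bond; box root, `1 ≤ L`). -/
theorem sum_abs_linCountAt_le (hL : 1 ≤ L) (hr : r ∈ box (d + 1) L) (μ : Fin (d + 1)) (y : Site (d + 1)) :
    ∑ x ∈ nearBox L y, ∑ α, |(linCountAt (toSite r) L μ y (α, x) : ℝ)|
      ≤ (nearBox L y).card * ((d + 1 : ℕ) * ((L : ℝ) ^ (d + 1) * (ell (d + 1) L : ℝ))) := by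
  have hb : ∀ x ∈ nearBox L y, ∑ α, |(linCountAt (toSite r) L μ y (α, x) : ℝ)| ≤ (d + 1 : ℕ) * ((L : ℝ) ^ (d + 1) * (ell (d + 1) L : ℝ)) := by
    intro x _
    have h1 : ∀ α ∈ (Finset.univ : Finset (Fin (d + 1))), |(linCountAt (toSite r) L μ y (α, x) : ℝ)| ≤ (L : ℝ) ^ (d + 1) * (ell (d + 1) L : ℝ) := by
      intro α _
      have h := abs_linCountAt_le hL μ y hr (α, x)
      rw [← Int.cast_abs]
      exact_mod_cast h
    refine (Finset.sum_le_sum h1).trans (le_of_eq ?_)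
    rw [Finset.sum_const, Finset.card_univ, Fintype.card_fin, nsmul_eq_mul]
  refine (Finset.sum_le_sum hb).trans (le_of_eq ?_)
  rw [Finset.sum_const, nsmul_eq_mul]

end Summit.QuantumFields.BalabanUV.Beta.GAN24.ContactFaceJumpCommutator

end
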